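/-
Origin: expansion seat `planner-pub-hodgecm-qw8b-g5-0`, handover #2 2026-08-18T09:40:14Z (`HOME/pub-hodgecm-qw8b-g5/lean/Qw8b5/EndStateHCCMNoN4.lean`, md5 13f35a3a, 113 lines);
landed by the gen-7 packager in gate run 27 as `HodgeCM/PerL34/EndStateHCCMNoN4.lean` (import ^import Qw8b5\.Qw8NoN4\b→import HodgeCM.StubTree.Qw8NoN4 ×1).
-/
/-
Copyright: pub-hodgecm formalisation cell (harness21, 2026). New file (not vendored).
Origin: HOME/pub-hodgecm-qw8b-g5/lean/Qw8b5/EndStateHCCMNoN4.lean — session planner-pub-hodgecm-qw8b-g5-0 (unit pub-hodgecm-qw8b-g5,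
QW8 SEAT 2, part (6b)(ii), generation 5), second file.  WIP module `Qw8b5.EndStateHCCMNoN4`; intended final place
`HodgeCM/PerL34/EndStateHCCMNoN4.lean` (module `HodgeCM.PerL34.EndStateHCCMNoN4`).  ADDITIVE LEAF: replaces nothing, nothing
imports it.  Imports: the landed `HodgeCM.PerL34.EndStateHCCM` (pv01-g5, gate run 26) and this seat's first file under its WIP
name `Qw8b5.Qw8NoN4` (HANDOVER #1, ↦ `HodgeCM.StubTree.Qw8NoN4`; ONE import line to rewrite); lands AFTER it.
-/
import Summits.HodgeConjecture.HodgeCM.PerL34.EndStateHCCM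
import Summits.HodgeConjecture.HodgeCM.StubTree.Qw8NoN4

/-!
# `HC_CM` end to end with the [QW8] side WITHOUT N4: (E8) becomes (E7)

`HodgeCM.PerL34.EndStateHCCM` (pv01-g5, run 26) composes the PerL-side end state (`EndStateShadow.EndState T Pc`: the thirteen
binders of the headline of record `AssemblyRoutes.perL_of_openCharsWeilLeavesCRΔ`) with the [QW8]-side presentation of record
(E8) = N1 `Fact_cupExterior`, N2 `Fact_cup_hodge`, N3 `Fact_pull_H0`, N4 `Fact_hodge_F0`, F4 `Fact_cupAlg`, F5 `Fact_cupAssoc`,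
F7d `Fact_gysinDescent`, M40 `Fact_dimProd` through `Assembly.COR_CM_of_descentFacts`.  By `HodgeCM.StubTree.Qw8NoN4`
(this seat's first file) N4 is not an input of that theorem (`Assembly.COR_CM_of_descentFacts₃`), so the end-to-end
statements hold with the SEVEN-fact list (E7) = N1, N2, N3, F4, F5, F7d, M40 — and, on the F-H0 route of
`StubTree/Qw8GysinDescentH0`, with N1, N2, N3, F4, F5, F-H0 `Fact_unitH0`, F7d-B `Fact_gysinDescentB`, M40:

* `hcCM_of_endState_descentFacts₃ (M) (E) (hN1 hN2 hN3 h4 h5 h7d hd) : U.HC_CM`;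
* `hcCM_of_endState_descentFactsB₃ (M) (E) (hN1 hN2 hN3 h4 h5 hu hb hd) : U.HC_CM`;
* `endToEnd₃ (M) (E) (…(E7)…) : U.HC_CM ∧ U.PerL44 ∧ U.PerL ∧ U.PeriodThmF ∧ U.W_RK4`;
* `hcCM_of_openCharsWeilLeavesCRΔ_descentFacts₃` — binders explicit, in the order and with the types of
  `hcCM_of_openCharsWeilLeavesCRΔ_descentFacts`, minus `hN4`.

Binder count of the end-to-end statement: `M` + 13 (PerL side) + 7 ([QW8] side) — was `M` + 13 + 8.  The proofs are those
of `EndStateHCCM` verbatim with `COR_CM_of_descentFacts₃` / `COR_CM_of_descentFactsB₃` for `COR_CM_of_descentFacts`.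
Nothing cited, nothing posited; Mathlib + the package only.
-/

set_option autoImplicit false

noncomputable section

open HodgeCM.Prior.Perl34File HodgeCM.Prior.Perl34File.Perl34 HodgeCM.PerL34.ArchC

namespace HodgeCM

namespace PerL34

namespace EndStateHCCM

open Universe Universe.ThetaModel AssemblyRoutes EndStateShadow EndStateThm44 CharSpansFinal

variable {U : Universe} {T : U.ThetaModel}
variable {Pc : ∀ {L : CMField} {ι₁ : L →+* ℂ} (V : HermSpace3 L ι₁) (c : SeesawCtx L),
  C4a.PointedCore (T.core V c)}

/-- **`HC_CM` END TO END without N4.**  Model axioms + the PerL-side end state + the [QW8]-side (E7) list: N1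
`Fact_cupExterior`, N2 `Fact_cup_hodge`, N3 `Fact_pull_H0`, F4 `Fact_cupAlg`, F5 `Fact_cupAssoc`, F7d `Fact_gysinDescent`,
M40 `Fact_dimProd` (compare `hcCM_of_endState_descentFacts`: `hN4` deleted). -/
theorem hcCM_of_endState_descentFacts₃ (M : U.ModelAxioms) (E : EndState T Pc)
    (hN1 : U.Fact_cupExterior) (hN2 : U.Fact_cup_hodge) (hN3 : U.Fact_pull_H0)
    (h4 : U.Fact_cupAlg) (h5 : U.Fact_cupAssoc) (h7d : U.Fact_gysinDescent) (hd : U.Fact_dimProd) : U.HC_CM :=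
  Assembly.COR_CM_of_descentFacts₃ U M (E.realisationExists M).2 hN1 hN2 hN3 h4 h5 h7d hd

/-- The same on the F-H0 route: N1, N2, N3, F4, F5, F-H0 `Fact_unitH0`, F7d-B `Fact_gysinDescentB`, M40. -/
theorem hcCM_of_endState_descentFactsB₃ (M : U.ModelAxioms) (E : EndState T Pc)
    (hN1 : U.Fact_cupExterior) (hN2 : U.Fact_cup_hodge) (hN3 : U.Fact_pull_H0)
    (h4 : U.Fact_cupAlg) (h5 : U.Fact_cupAssoc) (hu : U.Fact_unitH0) (hb : U.Fact_gysinDescentB)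
    (hd : U.Fact_dimProd) : U.HC_CM :=
  Assembly.COR_CM_of_descentFactsB₃ U M (E.realisationExists M).2 hN1 hN2 hN3 h4 h5 hu hb hd

/-- **Every conclusion of record at once** from the two end states, [QW8] side (E7): `HC_CM`, `PerL44`, `PerL`, the period
theorem face F and `W_RK4` (compare `endToEnd`). -/
theorem endToEnd₃ (M : U.ModelAxioms) (E : EndState T Pc)
    (hN1 : U.Fact_cupExterior) (hN2 : U.Fact_cup_hodge) (hN3 : U.Fact_pull_H0)
    (h4 : U.Fact_cupAlg) (h5 : U.Fact_cupAssoc) (h7d : U.Fact_gysinDescent) (hd : U.Fact_dimProd) :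
    U.HC_CM ∧ U.PerL44 ∧ U.PerL ∧ U.PeriodThmF ∧ U.W_RK4 :=
  have h := endState_conclusions M T E.h07 E.h09a E.h09b E.hM38 E.hAlb E.h12b E.hbr E.hQ Pc E.A12 E.A34 E.hch E.hW
  ⟨hcCM_of_endState_descentFacts₃ M E hN1 hN2 hN3 h4 h5 h7d hd, h.1, h.2.1, h.2.2.2.1, h.2.2.2.2.1⟩

/-- The landed (E8) statement is the special case with the redundant hypothesis `hN4`. -/
theorem hcCM_of_endState_descentFacts_eq₃ (M : U.ModelAxioms) (E : EndState T Pc)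
    (hN1 : U.Fact_cupExterior) (hN2 : U.Fact_cup_hodge) (hN3 : U.Fact_pull_H0) (hN4 : U.Fact_hodge_F0)
    (h4 : U.Fact_cupAlg) (h5 : U.Fact_cupAssoc) (h7d : U.Fact_gysinDescent) (hd : U.Fact_dimProd) :
    hcCM_of_endState_descentFacts M E hN1 hN2 hN3 hN4 h4 h5 h7d hd =
      hcCM_of_endState_descentFacts₃ M E hN1 hN2 hN3 h4 h5 h7d hd :=
  rfl

end EndStateHCCM

/-- **`HC_CM` END TO END without N4, binders explicit** (audited-list form): the model axioms `M`; the thirteen PerL-side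
binders in the order and with the types of `AssemblyRoutes.perL_of_openCharsWeilLeavesCRΔ`; the seven [QW8]-side (E7) facts
(N1–N3, F4, F5, F7d, M40).  Conclusion: `U.HC_CM`.  (Compare `hcCM_of_openCharsWeilLeavesCRΔ_descentFacts`: `hN4` deleted.) -/
theorem hcCM_of_openCharsWeilLeavesCRΔ_descentFacts₃ {U : Universe} (M : U.ModelAxioms) (T : U.ThetaModel)
    (h07 : N07_hodgeRiemann20 U) (h09a : N09a_embCover T) (h09b : N09b_innerEmb T)
    (hM38 : U.Fact_cmInflation) (hAlb : T.Fact_thetaAlbanese) (h12b : N12b_signRecipe T)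
    (hbr : ∀ {L : CMField} {ι₁ : L →+* ℂ} (V : HermSpace3 L ι₁) (c : SeesawCtx L), T.GoodCtx ι₁ c →
      Nonempty (SeesawDictionary.SeesawBridge T V c (T.t12 V c) 0 1))
    (hQ : ∀ {L : CMField} {ι₁ : L →+* ℂ} (V : HermSpace3 L ι₁) (c : SeesawCtx L), T.GoodCtx ι₁ c →
      Nonempty (QautDictionary.QautBridge T V c (T.t34 V c) 2 3))
    (Pc : ∀ {L : CMField} {ι₁ : L →+* ℂ} (V : HermSpace3 L ι₁) (c : SeesawCtx L),
      C4a.PointedCore (T.core V c))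
    (A12 : ∀ {L : CMField} {ι₁ : L →+* ℂ} (V : HermSpace3 L ι₁) (c : SeesawCtx L),
      T.GoodCtx ι₁ c → Nonempty (ArchCDatum (T.core V c) (T.t12 V c) (Pc V c)))
    (A34 : ∀ {L : CMField} {ι₁ : L →+* ℂ} (V : HermSpace3 L ι₁) (c : SeesawCtx L),
      T.GoodCtx ι₁ c → Nonempty (ArchCDatum (T.core V c) (T.t34 V c) (Pc V c)))
    (hch : T.Open_chars) (hW : CharSpansFinal.WeilStepsInputCRΔ T)
    (hN1 : U.Fact_cupExterior) (hN2 : U.Fact_cup_hodge) (hN3 : U.Fact_pull_H0)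
    (h4 : U.Fact_cupAlg) (h5 : U.Fact_cupAssoc) (h7d : U.Fact_gysinDescent) (hd : U.Fact_dimProd) : U.HC_CM :=
  EndStateHCCM.hcCM_of_endState_descentFacts₃ M
    (⟨h07, h09a, h09b, hM38, hAlb, h12b, hbr, hQ, A12, A34, hch, hW⟩ : EndStateShadow.EndState T Pc)
    hN1 hN2 hN3 h4 h5 h7d hd

end PerL34

end HodgeCM

end
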